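import Summits.Schanuel.Schanuel.Theorems.ZilberEacParamSurfaceRealRatioLemmas
import HarnessLib

/-!
# Polynomially parametrised base curves, XLVI: escaping exponential points for NON-SPLIT `Q` over
# an equal-degree curve with real irrational leading ratio — NO curvature condition

HONEST FRAMING.  Cell `pub-schanuel` (Zilber's Exponential-Algebraic Closedness, case ladder;
host summit Schanuel), seat 2, gen 21.  `deg g₀ = deg g₁ = n ≥ 2`, `Im(lc₁/lc₀) = 0`,
`λ = Re(lc₁/lc₀)` irrational, `D = lc(g₀) g₁ - lc(g₁) g₀` NON-CONSTANT (the base curve is not a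
line); `Q ∈ ℂ[t, y₀, y₁]` with two monomials of different `y₁`-degree.  Then there are `t_k` with
`Q(t_k; e^{g₀(t_k)}, e^{g₁(t_k)}) = 0` and `|Re g₀(t_k)|/log(2 + ‖g₀(t_k)‖) → ∞`
(`exists_paramSurface_expPoints_of_realRatio`).  Proof = gen 20's curved-real proof (file XXXV)
with: the root package of file XLIV for the escape polynomial `D' = -D/((λ+s)lc₀)` of degree
`m ∈ [1, n-1]` (`g₀ = R_s/(λ+s) + D'`, `R_s = g₁ + s g₀` the balance of the lower-left edge, `s ∈ ℚ`,
`λ + s ≠ 0`), a root direction `ω` of `R_s` with `Re(lc(D') ω^m) < 0` (`n ∤ m`), the engine of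
file XXXIII with `G = D'` and the off-edge estimate of file XLV, and the growth of `Re g₀` by the
Puiseux-gap lemma of file XXXIX (`e = 1`, real `c = 1/(λ+s)`), its value datum from file XLV.
Gen 20's curvature condition `lc₀(g₁)_{n-1} ≠ lc₁(g₀)_{n-1}` is the case `m = n - 1`.
Mantova–Masser's question is OPEN in general (PLMS 2024 §1 p. 5); NOT Schanuel's conjecture
(neither used nor implied; EAC ⇏ SC); `EC(3,2)` stays OPEN.
-/

noncomputable section

open Filter Topology Metric Set Complex MvPolynomial
open Literature.NumberTheory.Transcendental Literature.ModelTheory.Zilber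
open Literature.ModelTheory.ExponentialFields

set_option linter.dupNamespace false

namespace Summit.Schanuel.Schanuel.Theorems

/-- **Escaping zeros of `Q(t; e^{g₀(t)}, e^{g₁(t)})` over an equal-degree curve with real irrational
leading ratio, no curvature condition.**  See the module docstring. (new) -/
theorem exists_paramSurface_expPoints_of_realRatio (g₀ g₁ : Polynomial ℂ)
    (hn : 2 ≤ g₀.natDegree) (heq : g₁.natDegree = g₀.natDegree)
    (him : (g₁.leadingCoeff / g₀.leadingCoeff).im = 0)
    (hirr : Irrational (g₁.leadingCoeff / g₀.leadingCoeff).re)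
    (hD : 1 ≤ (Polynomial.C g₀.leadingCoeff * g₁ - Polynomial.C g₁.leadingCoeff * g₀).natDegree)
    (P : MvPolynomial (Fin 3) ℂ) (h2 : ∃ m ∈ P.support, ∃ m' ∈ P.support, m 2 ≠ m' 2) :
    ∃ t : ℕ → ℂ, (∀ k, MvPolynomial.eval ![t k, exp (g₀.eval (t k)), exp (g₁.eval (t k))] P = 0) ∧
      Tendsto (fun k => |(g₀.eval (t k)).re| / Real.log (2 + ‖g₀.eval (t k)‖)) atTop atTop := by
  classical
  have hg₀ : 1 ≤ g₀.natDegree := by omega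
  have hg₀0 : g₀ ≠ 0 := by rintro rfl; rw [Polynomial.natDegree_zero] at hn; omega
  have hlc₀ : g₀.leadingCoeff ≠ 0 := Polynomial.leadingCoeff_ne_zero.2 hg₀0
  obtain ⟨s, mb, hmb, hE1, hE2, ms, hmsA, hms2, hmsw⟩ := exists_lowerLeft_edge₃ P.support h2
  -- `λ + s ≠ 0` since `s ∈ ℚ`
  set lam : ℝ := (g₁.leadingCoeff / g₀.leadingCoeff).re with hlam
  have hs : lam + s ≠ 0 := by
    intro h0
    have hseq := edgeSlope_eq_div hms2 hmsw
    have hd0 : ((ms 2 : ℤ) - mb 2 : ℤ) ≠ 0 := by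
      have : (ms 2 : ℤ) ≠ mb 2 := by exact_mod_cast hms2
      omega
    apply hirr.ne_rational (-((ms 1 : ℤ) - mb 1)) ((ms 2 : ℤ) - mb 2)
    have : lam = -s := by linarith
    rw [this, hseq]
    push_cast
    ring
  have hratio : g₁.leadingCoeff / g₀.leadingCoeff = (lam : ℂ) := by
    apply Complex.ext
    · simp [hlam]
    · simp [him]
  have hlc₁ : g₁.leadingCoeff = (lam : ℂ) * g₀.leadingCoeff := by
    rw [← hratio]; field_simp
  obtain ⟨hdegR, hlcR, hsum0, -, -⟩ := balance_curvedReal hg₀ heq him s hs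
  set R₀ : Polynomial ℂ := g₁ + Polynomial.C (s : ℂ) * g₀ with hR₀
  have hdR : 2 ≤ R₀.natDegree := by rw [hdegR]; exact hn
  have hReval : ∀ t : ℂ, R₀.eval t = g₁.eval t + (s : ℂ) * g₀.eval t := by
    intro t; simp [hR₀, Polynomial.eval_add, Polynomial.eval_mul]
  have hsumlam : g₁.leadingCoeff + (s : ℂ) * g₀.leadingCoeff = ((lam + s : ℝ) : ℂ) * g₀.leadingCoeff := by
    rw [hlc₁]; push_cast; ring
  -- the decomposition `g₀ = c R₀ + D'`, `c = 1/(λ+s)` real, `D' = -D/((λ+s) lc₀)`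
  obtain ⟨Dn, hDn⟩ : ∃ Dn : Polynomial ℂ,
      Dn = Polynomial.C g₀.leadingCoeff * g₁ - Polynomial.C g₁.leadingCoeff * g₀ := ⟨_, rfl⟩
  rw [← hDn] at hD
  have hDn_lt : Dn.natDegree < g₀.natDegree := by
    have h := natDegree_gapPoly_lt g₀ g₁ (by omega) (heq ▸ dvd_rfl)
    rw [heq, Nat.div_self (by omega), pow_one, pow_one, ← hDn] at h
    exact h
  obtain ⟨cr, hcr⟩ : ∃ cr : ℝ, cr = 1 / (lam + s) := ⟨_, rfl⟩
  obtain ⟨κ', hκ'⟩ : ∃ κ' : ℂ, κ' = -1 / (g₁.leadingCoeff + (s : ℂ) * g₀.leadingCoeff) := ⟨_, rfl⟩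
  have hκ'0 : κ' ≠ 0 := by
    rw [hκ']; exact div_ne_zero (by norm_num) hsum0
  obtain ⟨D', hD'⟩ : ∃ D' : Polynomial ℂ, D' = Polynomial.C κ' * Dn := ⟨_, rfl⟩
  have hD'deg : D'.natDegree = Dn.natDegree := by rw [hD', Polynomial.natDegree_C_mul hκ'0]
  have hm1 : 1 ≤ D'.natDegree := by rw [hD'deg]; exact hD
  have hD'0 : D' ≠ 0 := by rintro h0; rw [h0, Polynomial.natDegree_zero] at hm1; omega
  have hlcD' : D'.leadingCoeff ≠ 0 := Polynomial.leadingCoeff_ne_zero.2 hD'0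
  have hndvd : ¬ g₀.natDegree ∣ D'.natDegree := by
    intro h
    have := Nat.le_of_dvd (by omega) h
    rw [hD'deg] at this
    omega
  have hls' : (lam : ℂ) + (s : ℂ) ≠ 0 := by
    rw [← Complex.ofReal_add]; exact Complex.ofReal_ne_zero.2 hs
  have key1 : (cr : ℂ) + κ' * g₀.leadingCoeff = 0 := by
    rw [hcr, hκ', hsumlam]
    push_cast
    field_simp
    ring
  have key2 : (cr : ℂ) * (s : ℂ) - κ' * g₁.leadingCoeff = 1 := by
    rw [hcr, hκ', hsumlam, hlc₁]
    push_cast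
    field_simp
    ring
  have hdecomp : g₀ = Polynomial.C (cr : ℂ) * R₀ ^ 1 + D' := by
    rw [pow_one, hD', hDn, hR₀]
    have e1 : Polynomial.C (cr : ℂ) * (g₁ + Polynomial.C (s : ℂ) * g₀) +
        Polynomial.C κ' * (Polynomial.C g₀.leadingCoeff * g₁ - Polynomial.C g₁.leadingCoeff * g₀) =
        Polynomial.C ((cr : ℂ) + κ' * g₀.leadingCoeff) * g₁ +
          Polynomial.C ((cr : ℂ) * (s : ℂ) - κ' * g₁.leadingCoeff) * g₀ := by
      simp only [map_add, map_mul, map_sub]; ring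
    rw [e1, key1, key2, Polynomial.C_0, Polynomial.C_1]; ring
  have hg₀eval : ∀ t : ℂ, g₀.eval t = (cr : ℂ) * R₀.eval t + D'.eval t := by
    intro t
    have := congrArg (fun p => Polynomial.eval t p) hdecomp
    simp only [Polynomial.eval_add, Polynomial.eval_mul, Polynomial.eval_C, pow_one] at this
    exact this
  -- a root direction of `R₀` with `Re(lc(D') ω^m) < 0` (`n ∤ m`)
  obtain ⟨ω, σ, hσ, hω, hdir⟩ := exists_rootDirection_re_neg_of_not_dvd
    (g₁.leadingCoeff + (s : ℂ) * g₀.leadingCoeff) D'.leadingCoeff hsum0 hlcD' hn hndvd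
  have hωR : R₀.leadingCoeff * ω ^ R₀.natDegree = 2 * Real.pi * I * σ := by
    rw [hlcR, hdegR]; exact hω
  -- the coefficient data of the edge (verbatim from file XXXV)
  set M := P.support.filter
    (fun m : Fin 3 →₀ ℕ => ((m 1 : ℝ) - s * m 2) = (mb 1 : ℝ) - s * mb 2) with hM
  set Nf := P.support.filter
    (fun m : Fin 3 →₀ ℕ => ¬ ((m 1 : ℝ) - s * m 2) = (mb 1 : ℝ) - s * mb 2) with hNf
  have hmbM : mb ∈ M := Finset.mem_filter.2 ⟨hmb, rfl⟩
  have hmsM : ms ∈ M := Finset.mem_filter.2 ⟨hmsA, hmsw⟩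
  have hMle : ∀ m ∈ M, mb 2 ≤ m 2 := fun m hm =>
    hE2 m (Finset.mem_filter.1 hm).1 (Finset.mem_filter.1 hm).2
  set q : (Fin 3 →₀ ℕ) → Polynomial ℂ := fun m =>
    Polynomial.C (P.coeff m) * Polynomial.X ^ (m 0) with hq_def
  set e : (Fin 3 →₀ ℕ) → ℕ := fun m => m 2 - mb 2 with he_def
  have hq_deg : ∀ m ∈ M, (q m).natDegree = m 0 := fun m hm =>
    Polynomial.natDegree_C_mul_X_pow _ _
      (MvPolynomial.mem_support_iff.1 (Finset.mem_filter.1 hm).1)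
  have hq_lc : ∀ m, (q m).leadingCoeff = P.coeff m := fun m =>
    Polynomial.leadingCoeff_C_mul_X_pow _ _
  obtain ⟨μ, κ, hκ, ma, hma, mc, hmc, hjne, hja, hjc⟩ := exists_upper_edge M e (fun m => m 0)
    ⟨mb, hmbM, ms, hmsM, by
      have hlt : mb 2 < ms 2 := lt_of_le_of_ne (hMle ms hmsM) (Ne.symm hms2)
      simp only [he_def]; omega⟩
  have hκ'e : ∀ m ∈ M, ((q m).natDegree : ℝ) + μ * e m ≤ κ := fun m hm => by
    rw [hq_deg m hm]; exact hκ m hm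
  set Jt := M.filter (fun m => ((q m).natDegree : ℝ) + μ * e m = κ) with hJt
  set Qμ : Polynomial ℂ := ∑ m ∈ Jt, Polynomial.C (q m).leadingCoeff * Polynomial.X ^ (e m)
    with hQμ
  have hmem_top : ∀ {m}, m ∈ M → ((m 0 : ℝ) + μ * e m = κ) → m ∈ Jt := fun {m} hm h =>
    Finset.mem_filter.2 ⟨hm, by rw [hq_deg m hm]; exact h⟩
  have hmaT : ma ∈ Jt := hmem_top hma hja
  have hmcT : mc ∈ Jt := hmem_top hmc hjc
  have hinj : ∀ m ∈ Jt, ∀ m' ∈ Jt, e m = e m' → m = m' := by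
    intro m hm m' hm' hee
    obtain ⟨hmM, hmt⟩ := Finset.mem_filter.1 hm
    obtain ⟨hm'M, hm't⟩ := Finset.mem_filter.1 hm'
    have h2eq : m 2 = m' 2 := by
      have := hMle m hmM; have := hMle m' hm'M
      simp only [he_def] at hee; omega
    have h0eq : m 0 = m' 0 := by
      rw [hq_deg m hmM] at hmt; rw [hq_deg m' hm'M] at hm't
      rw [hee] at hmt
      have : (m 0 : ℝ) = m' 0 := by linarith
      exact_mod_cast this
    exact gse_eq_of_weight_eq ((Finset.mem_filter.1 hmM).2.trans (Finset.mem_filter.1 hm'M).2.symm)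
      h2eq h0eq
  have hcoeff : ∀ m₁ ∈ Jt, Qμ.coeff (e m₁) = P.coeff m₁ := by
    intro m₁ hm₁
    rw [hQμ, Polynomial.finsetSum_coeff, Finset.sum_eq_single m₁]
    · rw [Polynomial.coeff_C_mul, Polynomial.coeff_X_pow, if_pos rfl, mul_one, hq_lc]
    · intro m hm hne
      rw [Polynomial.coeff_C_mul, Polynomial.coeff_X_pow, if_neg, mul_zero]
      exact fun h => hne (hinj m hm m₁ hm₁ h.symm)
    · intro h; exact (h hm₁).elim
  have hca : Qμ.coeff (e ma) ≠ 0 := by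
    rw [hcoeff ma hmaT]; exact MvPolynomial.mem_support_iff.1 (Finset.mem_filter.1 hma).1
  have hccf : Qμ.coeff (e mc) ≠ 0 := by
    rw [hcoeff mc hmcT]; exact MvPolynomial.mem_support_iff.1 (Finset.mem_filter.1 hmc).1
  obtain ⟨θ, hθ0, hθ⟩ : ∃ θ : ℂ, θ ≠ 0 ∧ Qμ.eval θ = 0 := by
    rcases lt_or_gt_of_ne hjne with hlt | hgt
    · exact exists_root_ne_zero_of_coeff_ne_zero (e mc) Qμ (e ma) hlt hca hccf
    · exact exists_root_ne_zero_of_coeff_ne_zero (e ma) Qμ (e mc) hgt hccf hca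
  have hQ : Qμ ≠ 0 := fun h => hca (by rw [h, Polynomial.coeff_zero])
  -- the weight gap, the weight ceiling and degree bounds
  obtain ⟨δ, hδpos, hδ⟩ : ∃ δ : ℝ, 0 < δ ∧ ∀ m ∈ P.support,
      ¬ ((m 1 : ℝ) - s * m 2) = (mb 1 : ℝ) - s * mb 2 →
        δ ≤ ((m 1 : ℝ) - s * m 2) - ((mb 1 : ℝ) - s * mb 2) := by
    by_cases hNe : Nf.Nonempty
    · obtain ⟨mm, hmm, hmmmin⟩ := Nf.exists_min_image
        (fun m => ((m 1 : ℝ) - s * m 2) - ((mb 1 : ℝ) - s * mb 2)) hNe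
      obtain ⟨hmmA, hmmw⟩ := Finset.mem_filter.1 hmm
      refine ⟨((mm 1 : ℝ) - s * mm 2) - ((mb 1 : ℝ) - s * mb 2), ?_, fun m hm hmw =>
        hmmmin m (Finset.mem_filter.2 ⟨hm, hmw⟩)⟩
      have := hE1 mm hmmA
      rcases this.lt_or_eq with h | h
      · linarith
      · exact absurd h.symm hmmw
    · refine ⟨1, zero_lt_one, fun m hm hmw => ?_⟩
      exact absurd ⟨m, Finset.mem_filter.2 ⟨hm, hmw⟩⟩ hNe
  obtain ⟨W, hW0, hW⟩ : ∃ W : ℝ, 0 ≤ W ∧ ∀ m ∈ P.support,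
      ((m 1 : ℝ) - s * m 2) - ((mb 1 : ℝ) - s * mb 2) ≤ W := by
    obtain ⟨mm, hmm, hmax⟩ := P.support.exists_max_image
      (fun m : Fin 3 →₀ ℕ => ((m 1 : ℝ) - s * m 2) - ((mb 1 : ℝ) - s * mb 2)) ⟨mb, hmb⟩
    refine ⟨max 0 (((mm 1 : ℝ) - s * mm 2) - ((mb 1 : ℝ) - s * mb 2)), le_max_left _ _,
      fun m hm => (hmax m hm).trans (le_max_right _ _)⟩
  set N : ℕ := P.support.sup (fun m => m 0) with hNdef
  have hN : ∀ m ∈ P.support, m 0 ≤ N := fun m hm => Finset.le_sup (f := fun m => m 0) hm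
  set N₂ : ℕ := P.support.sup (fun m => m 2) with hN₂def
  have hN₂ : ∀ m ∈ P.support, m 2 ≤ N₂ := fun m hm => Finset.le_sup (f := fun m => m 2) hm
  set N' : ℕ := ⌈(N₂ : ℝ) * |μ|⌉₊ with hN'def
  have hN' : ∀ m ∈ P.support, |(m 2 : ℝ) - mb 2| * |μ| ≤ N' := by
    intro m hm
    have h1 : |(m 2 : ℝ) - mb 2| ≤ N₂ := by
      rw [abs_le]
      constructor
      · have : (mb 2 : ℝ) ≤ N₂ := by exact_mod_cast hN₂ mb hmb
        linarith [(Nat.cast_nonneg (m 2) : (0 : ℝ) ≤ m 2)]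
      · have : (m 2 : ℝ) ≤ N₂ := by exact_mod_cast hN₂ m hm
        linarith [(Nat.cast_nonneg (mb 2) : (0 : ℝ) ≤ mb 2)]
    exact (mul_le_mul_of_nonneg_right h1 (abs_nonneg μ)).trans (Nat.le_ceil _)
  set N'' : ℕ := ⌈W * (|cr| * |μ|)⌉₊ with hN''def
  have hN'' : W * (|cr| * |μ|) ≤ N'' := Nat.le_ceil _
  set E : ℂ → ℂ := fun t => ∑ m ∈ Nf, P.coeff m * t ^ (m 0) *
    exp ((((m 1 : ℝ) - s * m 2 - ((mb 1 : ℝ) - s * mb 2) : ℝ) : ℂ) * g₀.eval t +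
      (((m 2 : ℝ) - mb 2 : ℝ) : ℂ) * R₀.eval t) with hEdef
  have hEdiff : Differentiable ℂ E := by
    refine Differentiable.fun_sum fun m _ => ?_
    refine ((differentiable_const _).mul (differentiable_id.pow _)).mul ?_
    refine (((differentiable_const _).mul (Polynomial.differentiable _)).add
      ((differentiable_const _).mul (Polynomial.differentiable _))).cexp
  have hEb : ∀ B : ℝ, ∃ C : ℝ, 0 ≤ C ∧ ∃ N₃ : ℕ, ∀ t : ℂ, (D'.eval t).re ≤ 0 → 1 ≤ ‖t‖ →
      |(R₀.eval t).re - μ * Real.log ‖t‖| ≤ B →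
        ‖E t‖ ≤ C * (1 + ‖t‖) ^ N₃ * Real.exp (δ * (D'.eval t).re) := by
    intro B
    refine ⟨∑ m ∈ Nf, ‖P.coeff m‖ * Real.exp (|(m 2 : ℝ) - mb 2| * B) * Real.exp (W * |(|cr| * B)|),
      Finset.sum_nonneg fun m _ => by positivity, N + N' + N'', fun t ht ht1 htB => ?_⟩
    have htB' : |(g₁.eval t + (s : ℂ) * g₀.eval t).re - μ * Real.log ‖t‖| ≤ B := by
      rwa [hReval] at htB
    have hz : (g₀.eval t).re ≤ |cr| * |μ| * Real.log ‖t‖ + |cr| * B + (D'.eval t).re := by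
      rw [hg₀eval t, Complex.add_re, Complex.re_ofReal_mul]
      have hlog0 : 0 ≤ Real.log ‖t‖ := Real.log_nonneg ht1
      have h1 : |(R₀.eval t).re| ≤ |μ| * Real.log ‖t‖ + B := by
        have := abs_sub_abs_le_abs_sub (R₀.eval t).re (μ * Real.log ‖t‖)
        rw [abs_mul, abs_of_nonneg hlog0] at this
        linarith
      have h2 : cr * (R₀.eval t).re ≤ |cr| * (|μ| * Real.log ‖t‖ + B) := by
        calc cr * (R₀.eval t).re ≤ |cr * (R₀.eval t).re| := le_abs_self _
          _ = |cr| * |(R₀.eval t).re| := abs_mul _ _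
          _ ≤ |cr| * (|μ| * Real.log ‖t‖ + B) := mul_le_mul_of_nonneg_left h1 (abs_nonneg _)
      linarith
    have h := norm_offEdgeSum₃_le_log₃ (P := P) hδpos hδ hW hN hN' (by positivity) hN''
      (t := t) ht hz ht1 htB'
    simp only [hEdef, hReval]
    exact h
  -- the root package with decay of `D'`, and the engine of file XXXIII with `G = D'`
  set c₀ : ℂ := Complex.log θ with hc₀_def
  have hc₀ : exp c₀ = θ := Complex.exp_log hθ0
  obtain ⟨z₀, Lg, Λ, Λ', K₀, hΛ, hΛ'0, hdecay, hpos, hroot⟩ :=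
    exists_ray_roots_log_rem R₀ D' hdR hm1 ω σ hσ hωR hdir μ c₀
  obtain ⟨t, K₁, ht, hdist⟩ := exists_escape_zeros_log_of_roots R₀ D' hdR M q e μ κ hκ'e hθ0 hθ
    hQ z₀ Lg Λ Λ' hΛ hΛ'0 hdecay (fun j => (hroot j).1)
    (fun j => by rw [(hroot j).2.1, hc₀]) (fun j => (hroot j).2.2.1) (fun j => (hroot j).2.2.2.1)
    (fun j => (hroot j).2.2.2.2.1) (fun j => (hroot j).2.2.2.2.2.1)
    (fun j => (hroot j).2.2.2.2.2.2.1) (fun j => (hroot j).2.2.2.2.2.2.2) E hEdiff hδpos hEb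
  refine ⟨t, fun k => ?_, ?_⟩
  · rw [eval₃_exp_exp_eq_mul_edgeSum hE2 (t k) (g₀.eval (t k)) (g₁.eval (t k))]
    have h := ht k
    rw [hEdef] at h
    simp only [hReval] at h
    rw [h, mul_zero]
  · -- growth: position `t_k - ρ_k ω → τ`, value datum from the distance to the roots, file XXXIX
    have hz₀norm : Tendsto (fun j => ‖z₀ j‖) atTop atTop :=
      tendsto_atTop_mono (fun j => (hroot j).2.2.2.2.1)
        (hΛ.atTop_div_const (by norm_num : (0 : ℝ) < 3))
    have hapos : 0 < ‖R₀.leadingCoeff‖ := norm_pos_iff.2 (by rw [hlcR]; exact hsum0)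
    have hd1 : 1 ≤ R₀.natDegree - 1 := by omega
    have hsmall : ∀ k, 2 / (‖R₀.leadingCoeff‖ * ‖z₀ (k + K₁)‖ ^ (R₀.natDegree - 1)) ≤
        2 / (‖R₀.leadingCoeff‖ * ‖z₀ (k + K₁)‖) := by
      intro k
      have hz1 : 1 ≤ ‖z₀ (k + K₁)‖ := (hroot (k + K₁)).2.2.1
      refine div_le_div_of_nonneg_left (by norm_num) (by positivity) ?_
      refine mul_le_mul_of_nonneg_left ?_ hapos.le
      calc ‖z₀ (k + K₁)‖ = ‖z₀ (k + K₁)‖ ^ 1 := (pow_one _).symm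
        _ ≤ ‖z₀ (k + K₁)‖ ^ (R₀.natDegree - 1) := pow_le_pow_right₀ hz1 hd1
    have h1 : Tendsto (fun k => t k - z₀ (k + K₁)) atTop (𝓝 0) := by
      have hb : Tendsto (fun k => 2 / (‖R₀.leadingCoeff‖ * ‖z₀ (k + K₁)‖)) atTop (𝓝 0) :=
        tendsto_const_nhds.div_atTop
          ((hz₀norm.comp (tendsto_add_atTop_nat K₁)).const_mul_atTop hapos)
      exact tendsto_zero_iff_norm_tendsto_zero.2
        (squeeze_zero (fun k => norm_nonneg _) (fun k => (hdist k).trans (hsmall k)) hb)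
    have h2 := hpos.comp (tendsto_add_atTop_nat K₁)
    have h3 := h1.add h2
    rw [zero_add] at h3
    have hρ : Tendsto (fun k => (((k + K₁ + K₀ : ℕ) : ℝ)) + 1) atTop atTop :=
      (tendsto_natCast_add_atTop 1).comp
        ((tendsto_add_atTop_nat K₀).comp (tendsto_add_atTop_nat K₁))
    -- the value datum: `‖t_k - z₀‖ ≤ 1` since `‖z₀‖ ≥ 16` and `‖lc(R₀)‖ ‖z₀‖ ≥ 2`
    have hval : ∀ k, |(R₀.eval (t k)).re - μ * Real.log ‖t k‖| ≤
        |Real.log ‖θ‖| + coeffNormSum R₀ * R₀.natDegree * 2 ^ R₀.natDegree / ‖R₀.leadingCoeff‖ +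
          |μ| := by
      intro k
      obtain ⟨hLz, hz₀e, hz1, hz2, -, -, hz16, -⟩ := hroot (k + K₁)
      have hReL : (Lg (k + K₁)).re = Real.log ‖z₀ (k + K₁)‖ := re_eq_log_norm_of_exp_eq hLz
      have hre : (R₀.eval (z₀ (k + K₁))).re = Real.log ‖θ‖ + μ * Real.log ‖z₀ (k + K₁)‖ := by
        have h1' := congrArg (fun w => ‖w‖) hz₀e
        simp only [norm_mul, Complex.norm_exp, Complex.re_ofReal_mul, hReL, hc₀] at h1'
        have h2' := congrArg Real.log h1'
        rwa [Real.log_exp, Real.log_mul (norm_ne_zero_iff.2 hθ0) (Real.exp_pos _).ne',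
          Real.log_exp] at h2'
      have hdist1 : ‖t k - z₀ (k + K₁)‖ ≤ 1 := by
        refine (hdist k).trans ((hsmall k).trans ?_)
        rw [div_le_one (by positivity)]
        linarith
      exact abs_re_sub_log_le_of_near_root R₀ (by omega) (by linarith) hre hdist1 (hdist k)
    have hph : ((cr : ℂ) * I ^ 1).re = 0 := by simp
    have hgap : R₀.natDegree * (1 - 1) + 1 ≤ D'.natDegree := by simpa using hm1
    have hgrowth := tendsto_growth_eval_of_gap R₀ (cr : ℂ) 1 hph D' hgap ω
      (-(R₀.coeff (R₀.natDegree - 1) / (R₀.natDegree * R₀.leadingCoeff))) hdir.ne hρ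
      (t := t) (by
        refine h3.congr fun k => ?_
        simp only [Function.comp_apply]
        push_cast
        ring) hval
    rw [← hdecomp] at hgrowth
    exact hgrowth

end Summit.Schanuel.Schanuel.Theorems
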